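import Literature.Geometry.Riemannian.GurskyViaclovskyClosednessChartBounds
import HarnessLib

/-!
# Gursky–Viaclovsky closedness: frame norm of a covector versus its Euclidean norm

Support file (everything PROVED; no definition, no named fact) for the named fact
`Literature.Geometry.Riemannian.gurskyViaclovsky_pathClosed_weighted_four`.

`symbol_uniformlyElliptic_along_solution` (ChartEllipticity file) gives Gilbarg–Trudinger's
structure condition (17.43) for the chart form of the background equation in the FRAME norm
`Σ_a η(b_a)²` of the covector `η` (`b` a `g_y`-orthonormal frame), whereas (17.43) is stated with
the Euclidean `|ξ|²`. This file supplies the two-sided comparison, for any frame `e` with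
`‖e_a‖ ≤ κ` and the expansion `v = Σ_a G₀(v, e_a) e_a` with `‖G₀‖ ≤ Λ` (both available on
compact chart balls from `chart_c2_bounds`' ingredients `norm_le_sqrt_inv_of_unit`,
`sum_smul_frame_eq`):

* `sum_sq_frame_le` — `Σ_a η(e_a)² ≤ (#ι) κ² ‖η‖²`;
* `norm_sq_le_sum_sq_frame` — `‖η‖² ≤ (Λκ)² (#ι) Σ_a η(e_a)²`.

## References

* D. Gilbarg, N. S. Trudinger, *Elliptic Partial Differential Equations of Second Order* (2001),
  §17.4, (17.43). [GilbargTrudinger2001]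
* M. J. Gursky, J. A. Viaclovsky, J. Differential Geom. 63 (2003) 131–154, Prop. 6.
  [GurskyViaclovsky2003]
-/

noncomputable section

open Finset

namespace Literature.Geometry.Riemannian.GurskyViaclovskyPath

section Covector

variable {E : Type*} [NormedAddCommGroup E] [NormedSpace ℝ E] {ι : Type*} [Fintype ι]

/-- **Frame norm ≤ Euclidean norm**: `Σ_a η(e_a)² ≤ (#ι) κ² ‖η‖²` when `‖e_a‖ ≤ κ`.
[folklore] -/
theorem sum_sq_frame_le (e : ι → E) {κ : ℝ} (hκ : ∀ a, ‖e a‖ ≤ κ) (η : E →L[ℝ] ℝ) : ∑ a, η (e a) ^ 2 ≤ Fintype.card ι * κ ^ 2 * ‖η‖ ^ 2 := by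
  have h1 : ∀ a, η (e a) ^ 2 ≤ κ ^ 2 * ‖η‖ ^ 2 := fun a ↦ by
    have h := η.le_opNorm (e a)
    rw [Real.norm_eq_abs] at h
    have h' : |η (e a)| ≤ ‖η‖ * κ := h.trans (mul_le_mul_of_nonneg_left (hκ a) (norm_nonneg _))
    calc η (e a) ^ 2 = |η (e a)| ^ 2 := (sq_abs _).symm
      _ ≤ (‖η‖ * κ) ^ 2 := pow_le_pow_left₀ (abs_nonneg _) h' 2
      _ = κ ^ 2 * ‖η‖ ^ 2 := by ring
  calc ∑ a, η (e a) ^ 2 ≤ ∑ _a : ι, κ ^ 2 * ‖η‖ ^ 2 := sum_le_sum fun a _ ↦ h1 a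
    _ = Fintype.card ι * κ ^ 2 * ‖η‖ ^ 2 := by
      rw [sum_const, nsmul_eq_mul, Finset.card_univ]; ring

/-- **Euclidean norm ≤ frame norm**: `‖η‖² ≤ (Λκ)² (#ι) Σ_a η(e_a)²` when
`v = Σ_a G₀(v, e_a) e_a`, `‖G₀‖ ≤ Λ`, `‖e_a‖ ≤ κ` (operator norm through the frame, then
Cauchy–Schwarz). [folklore] -/
theorem norm_sq_le_sum_sq_frame (G₀ : E →L[ℝ] E →L[ℝ] ℝ) (e : ι → E)
    (hexp : ∀ v, ∑ a, G₀ v (e a) • e a = v) {Λ κ : ℝ} (hΛ : ‖G₀‖ ≤ Λ) (hκ : ∀ a, ‖e a‖ ≤ κ)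
    (hκ0 : 0 ≤ κ) (η : E →L[ℝ] ℝ) :
    ‖η‖ ^ 2 ≤ (Λ * κ) ^ 2 * Fintype.card ι * ∑ a, η (e a) ^ 2 := by
  have hΛ0 : 0 ≤ Λ := (norm_nonneg G₀).trans hΛ
  have h1 := opNorm_le_of_frame G₀ e hexp hΛ hκ hκ0 η
  simp only [Real.norm_eq_abs] at h1
  have hs0 : 0 ≤ ∑ a, |η (e a)| := sum_nonneg fun a _ ↦ abs_nonneg _
  have h2 : ‖η‖ ^ 2 ≤ (Λ * κ) ^ 2 * (∑ a, |η (e a)|) ^ 2 := by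
    calc ‖η‖ ^ 2 ≤ (Λ * κ * ∑ a, |η (e a)|) ^ 2 := pow_le_pow_left₀ (norm_nonneg _) h1 2
      _ = (Λ * κ) ^ 2 * (∑ a, |η (e a)|) ^ 2 := by ring
  have h3 : (∑ a, |η (e a)|) ^ 2 ≤ Fintype.card ι * ∑ a, η (e a) ^ 2 := by
    have h := sq_sum_le_card_mul_sum_sq (s := (univ : Finset ι)) (f := fun a ↦ |η (e a)|)
    simp only [sq_abs, Finset.card_univ] at h
    exact h
  calc ‖η‖ ^ 2 ≤ (Λ * κ) ^ 2 * (∑ a, |η (e a)|) ^ 2 := h2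
    _ ≤ (Λ * κ) ^ 2 * (Fintype.card ι * ∑ a, η (e a) ^ 2) :=
      mul_le_mul_of_nonneg_left h3 (by positivity)
    _ = (Λ * κ) ^ 2 * Fintype.card ι * ∑ a, η (e a) ^ 2 := by ring

end Covector

end Literature.Geometry.Riemannian.GurskyViaclovskyPath

end
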